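import Mathlib
import Summits.Ventures.PercRepro2.Defs
import Summits.Ventures.PercRepro2.Independence
import Summits.Ventures.PercRepro2.Harris
import Summits.Ventures.PercRepro2.Graph
import Summits.Ventures.PercRepro2.Exploration
import Summits.Ventures.PercRepro2.Events
import Summits.Ventures.PercRepro2.FourFunctions
import Summits.Ventures.PercRepro2.Induced
import Summits.Ventures.PercRepro2.Frontier
import Summits.Ventures.PercRepro2.ObsIndependence
import Summits.Ventures.PercRepro2.BHK
import Summits.Ventures.PercRepro2.BHKEvents
import Summits.Ventures.PercRepro2.OrderPreservation
import Summits.Ventures.PercRepro2.OrderPreservationDual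
import Summits.Ventures.PercRepro2.VdBKahn
import Summits.Ventures.PercRepro2.BHKAvoid
import Summits.Ventures.PercRepro2.R2PrimeThreeReduction
import Summits.Ventures.PercRepro2.YBridge
import Summits.Ventures.PercRepro2.Yu1Functionals
import Summits.Ventures.PercRepro2.Yu1Events
import Summits.Ventures.PercRepro2.Yu1
import Summits.Ventures.PercRepro2.LBSplit
import Summits.Ventures.PercRepro2.YDelta

/-!
# The threshold form of (Yu1Δ) (blind cell PercRepro2, typer-1; lead g6 2026-08-22T22:19:50Z,
exact bookkeeping after NEG-31)

Masses of the light exploration (`a₁` light, `a₂` heavy, `R = {a₂, a₃ ∉ C₁}`, `T = R ∩ {a₃ ∈ C₂}`,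
`PD = R ∩ {a₃ ∉ C₂}`): `A = P(o ∈ C₁, b ∈ C₂, R)`, `A′ = P(o ∈ C₁, b ∈ C₁, T)`, `N_h = P(b ∈ C₂, R)`,
`r_b = P(b ∈ C₁, T)`, `C = P(PD, o ∈ C₁)`, `D = P(PD)`, and `W = M₂ + Δ_T = N_h − r_b`
(`W_eq_Nh_sub_rb`).  Conditional shares: `s_H = A / N_h = P(o ∈ C₁ | b ∈ C₂, R)`,
`s_L3 = A′ / r_b = P(o ∈ C₁ | b ∈ C₁, a₃ ∈ C₂, R)`, `g_l = C / D = P(o ∈ C₁ | PD)`,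
`g⁻ = P(o ∈ C₁ | PD, b ∉ C₁)`, `g⁺ = P(o ∈ C₁ | PD, b ∈ C₁)`, `ε = P(o ∈ C₁ | R)`.

* **The threshold** `x* = s_H + (r_b / W) (s_H − s_L3)`; `xstar_eq_div`: `x* = (A − A′) / W`
  `= (T_{l→h} − Δ_l) / W` (`xstar_eq_Tlh_sub_deltaL_div`).
* **The three rows share one threshold** (positive conditioning masses):
  `Yu1Delta ↔ x* ≤ g_l` (`Yu1Delta_iff_xstar_le_gl`), `LB ↔ x* ≤ g⁺` (`LB_iff_xstar_le_gPlus`,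
  a theorem under the labelling), `LA ↔ x* ≤ g⁻` (`LA_iff_xstar_le_gMinus`, FALSE by NEG-31), and
  `g_l` is the `D⁻, D⁺`-convex combination of `g⁻, g⁺` (`gl_eq_convex`).
* **Anatomy** (both BHK steps, product form): `s_H ≤ ε` (`A · P(R) ≤ P(o ∈ C₁, R) · N_h`,
  `massA_mul_le`, BHK 1.3 with `1_o` increasing, `β` decreasing) and `ε ≤ g_l`
  (`P(o ∈ C₁, R) · D ≤ C · P(R)`, `massO_mul_le`, BHK 1.1 with `1_o, u` increasing); hence
  `s_H ≤ g_l` when `P(R) > 0` (`shareH_le_gl`).  So (Yu1Δ) `⟺ N_h (g_l − s_H) ≥ r_b (g_l − s_L3)`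
  (`Yu1Delta_iff_threshold`): the PD-share of `o` must exceed the `(b ∈ C_h)`-share by
  `(r_b / W)(s_H − s_L3)`.
-/

namespace Summit.Ventures.PercRepro2

open UnionCluster Yu1

namespace Threshold

section ThresholdDefs

variable {V : Type*} {E : Type*} [Fintype E] [DecidableEq E] [DecidableEq V]
  {R : Type*} [Field R]

/-- `A = P(o ∈ C₁, b ∈ C₂, R)`. -/
noncomputable def massA (p : E → R) (ends : E → Sym2 V) (o a₁ a₂ a₃ b : V) : R :=
  prob p (connEvent ends a₁ o ∩ connEvent ends a₂ b ∩ avoidAll ends a₁ {a₂, a₃})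

/-- `A′ = P(o ∈ C₁, b ∈ C₁, T)`. -/
noncomputable def massA' (p : E → R) (ends : E → Sym2 V) (o a₁ a₂ a₃ b : V) : R :=
  prob p (connEvent ends a₁ o ∩ connEvent ends a₁ b ∩ TEvent ends a₁ a₂ a₃)

/-- `N_h = P(b ∈ C₂, R)`. -/
noncomputable def Nh (p : E → R) (ends : E → Sym2 V) (a₁ a₂ a₃ b : V) : R :=
  prob p (connEvent ends a₂ b ∩ avoidAll ends a₁ {a₂, a₃})

/-- `r_b = P(b ∈ C₁, T)`. -/
noncomputable def rb (p : E → R) (ends : E → Sym2 V) (a₁ a₂ a₃ b : V) : R :=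
  prob p (connEvent ends a₁ b ∩ TEvent ends a₁ a₂ a₃)

/-- `P(o ∈ C₁, R)`. -/
noncomputable def massO (p : E → R) (ends : E → Sym2 V) (o a₁ a₂ a₃ : V) : R :=
  prob p (connEvent ends a₁ o ∩ avoidAll ends a₁ {a₂, a₃})

/-- `s_H = P(o ∈ C₁ | b ∈ C₂, R) = A / N_h` (Lean: `x / 0 = 0`). -/
noncomputable def shareH (p : E → R) (ends : E → Sym2 V) (o a₁ a₂ a₃ b : V) : R :=
  massA p ends o a₁ a₂ a₃ b / Nh p ends a₁ a₂ a₃ b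

/-- `s_L3 = P(o ∈ C₁ | b ∈ C₁, a₃ ∈ C₂, R) = A′ / r_b`. -/
noncomputable def shareL3 (p : E → R) (ends : E → Sym2 V) (o a₁ a₂ a₃ b : V) : R :=
  massA' p ends o a₁ a₂ a₃ b / rb p ends a₁ a₂ a₃ b

/-- `g_l = P(o ∈ C₁ | PD)`. -/
noncomputable def gl (p : E → R) (ends : E → Sym2 V) (o a₁ a₂ a₃ : V) : R :=
  prob p (PDEvent ends a₁ a₂ a₃ ∩ connEvent ends a₁ o) / prob p (PDEvent ends a₁ a₂ a₃)

/-- `g⁻ = P(o ∈ C₁ | PD, b ∉ C₁)`. -/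
noncomputable def gMinus (p : E → R) (ends : E → Sym2 V) (o a₁ a₂ a₃ b : V) : R :=
  prob p (PDEvent ends a₁ a₂ a₃ ∩ connEvent ends a₁ o ∩ (connEvent ends a₁ b)ᶜ) /
    prob p (PDEvent ends a₁ a₂ a₃ ∩ (connEvent ends a₁ b)ᶜ)

/-- `g⁺ = P(o ∈ C₁ | PD, b ∈ C₁)`. -/
noncomputable def gPlus (p : E → R) (ends : E → Sym2 V) (o a₁ a₂ a₃ b : V) : R :=
  prob p (PDEvent ends a₁ a₂ a₃ ∩ connEvent ends a₁ o ∩ connEvent ends a₁ b) /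
    prob p (PDEvent ends a₁ a₂ a₃ ∩ connEvent ends a₁ b)

/-- **The threshold** `x* = s_H + (r_b / W) (s_H − s_L3)`, `W = M₂ + Δ_T`. -/
noncomputable def xstar (p : E → R) (ends : E → Sym2 V) (o a₁ a₂ a₃ b : V) : R :=
  shareH p ends o a₁ a₂ a₃ b +
    rb p ends a₁ a₂ a₃ b / (massM2 p ends a₁ a₂ a₃ b + deltaT p ends a₁ a₂ a₃ b) *
      (shareH p ends o a₁ a₂ a₃ b - shareL3 p ends o a₁ a₂ a₃ b)

end ThresholdDefs

section ThresholdIdentities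

variable {V : Type*} {E : Type*} [Fintype E] [DecidableEq E] [Fintype V] [DecidableEq V]
  {R : Type*} [Field R] [LinearOrder R] [IsStrictOrderedRing R]

omit [Fintype V] [LinearOrder R] [IsStrictOrderedRing R] in
/-- `W = M₂ + Δ_T = N_h − r_b`. -/
lemma W_eq_Nh_sub_rb (p : E → R) (ends : E → Sym2 V) (a₁ a₂ a₃ b : V) :
    massM2 p ends a₁ a₂ a₃ b + deltaT p ends a₁ a₂ a₃ b =
      Nh p ends a₁ a₂ a₃ b - rb p ends a₁ a₂ a₃ b := by
  unfold Nh rb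
  rw [Nh_eq p ends a₁ a₂ a₃ b]
  unfold deltaT
  ring

omit [Fintype V] [LinearOrder R] [IsStrictOrderedRing R] in
/-- `T_{l→h} − Δ_l = A − A′` (`Tlh_sub_deltaL` in the threshold vocabulary). -/
lemma Tlh_sub_deltaL_eq (p : E → R) (ends : E → Sym2 V) (o a₁ a₂ a₃ b : V) :
    prob p (PDEvent ends a₁ a₂ a₃ ∩ connEvent ends a₁ o ∩ connEvent ends a₂ b) -
        deltaL p ends o a₁ a₂ a₃ b =
      massA p ends o a₁ a₂ a₃ b - massA' p ends o a₁ a₂ a₃ b :=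
  Tlh_sub_deltaL p ends o a₁ a₂ a₃ b

omit [Fintype V] [LinearOrder R] [IsStrictOrderedRing R] in
/-- **`x* = (A − A′) / W`**: the threshold is the (Yu1Δ)-ratio itself (needs `N_h, r_b, W ≠ 0`). -/
theorem xstar_eq_div (p : E → R) (ends : E → Sym2 V) (o a₁ a₂ a₃ b : V)
    (hN : Nh p ends a₁ a₂ a₃ b ≠ 0) (hr : rb p ends a₁ a₂ a₃ b ≠ 0)
    (hW : massM2 p ends a₁ a₂ a₃ b + deltaT p ends a₁ a₂ a₃ b ≠ 0) :
    xstar p ends o a₁ a₂ a₃ b =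
      (massA p ends o a₁ a₂ a₃ b - massA' p ends o a₁ a₂ a₃ b) /
        (massM2 p ends a₁ a₂ a₃ b + deltaT p ends a₁ a₂ a₃ b) := by
  have hWe := W_eq_Nh_sub_rb p ends a₁ a₂ a₃ b
  unfold xstar shareH shareL3
  rw [hWe] at hW ⊢
  field_simp
  ring

omit [Fintype V] [LinearOrder R] [IsStrictOrderedRing R] in
/-- `x* = (T_{l→h} − Δ_l) / W`. -/
theorem xstar_eq_Tlh_sub_deltaL_div (p : E → R) (ends : E → Sym2 V) (o a₁ a₂ a₃ b : V)
    (hN : Nh p ends a₁ a₂ a₃ b ≠ 0) (hr : rb p ends a₁ a₂ a₃ b ≠ 0)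
    (hW : massM2 p ends a₁ a₂ a₃ b + deltaT p ends a₁ a₂ a₃ b ≠ 0) :
    xstar p ends o a₁ a₂ a₃ b =
      (prob p (PDEvent ends a₁ a₂ a₃ ∩ connEvent ends a₁ o ∩ connEvent ends a₂ b) -
          deltaL p ends o a₁ a₂ a₃ b) /
        (massM2 p ends a₁ a₂ a₃ b + deltaT p ends a₁ a₂ a₃ b) := by
  rw [xstar_eq_div p ends o a₁ a₂ a₃ b hN hr hW, Tlh_sub_deltaL_eq]

omit [Fintype V] in
/-- **(Yu1Δ) is `g_l ≥ x*`** when `P(PD) > 0`, `W > 0` (and `N_h, r_b ≠ 0` so that the shares are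
genuine ratios). -/
theorem Yu1Delta_iff_xstar_le_gl (p : E → R) (ends : E → Sym2 V) (o a₁ a₂ a₃ b : V)
    (hN : Nh p ends a₁ a₂ a₃ b ≠ 0) (hr : rb p ends a₁ a₂ a₃ b ≠ 0)
    (hW : 0 < massM2 p ends a₁ a₂ a₃ b + deltaT p ends a₁ a₂ a₃ b)
    (hD : 0 < prob p (PDEvent ends a₁ a₂ a₃)) :
    Yu1Delta p ends o a₁ a₂ a₃ b ↔ xstar p ends o a₁ a₂ a₃ b ≤ gl p ends o a₁ a₂ a₃ := by
  rw [xstar_eq_div p ends o a₁ a₂ a₃ b hN hr hW.ne', ← Tlh_sub_deltaL_eq]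
  unfold gl Yu1Delta
  rw [div_le_div_iff₀ hW hD]
  constructor
  · intro h
    linarith
  · intro h
    linarith

omit [Fintype V] in
/-- **(L_B) is `g⁺ ≥ x*`** when `P(PD, b ∈ C₁) > 0`, `W > 0`. -/
theorem LB_iff_xstar_le_gPlus (p : E → R) (ends : E → Sym2 V) (o a₁ a₂ a₃ b : V)
    (hN : Nh p ends a₁ a₂ a₃ b ≠ 0) (hr : rb p ends a₁ a₂ a₃ b ≠ 0)
    (hW : 0 < massM2 p ends a₁ a₂ a₃ b + deltaT p ends a₁ a₂ a₃ b)
    (hD : 0 < prob p (PDEvent ends a₁ a₂ a₃ ∩ connEvent ends a₁ b)) :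
    LB p ends o a₁ a₂ a₃ b ↔ xstar p ends o a₁ a₂ a₃ b ≤ gPlus p ends o a₁ a₂ a₃ b := by
  rw [xstar_eq_div p ends o a₁ a₂ a₃ b hN hr hW.ne', ← Tlh_sub_deltaL_eq]
  unfold gPlus LB
  rw [div_le_div_iff₀ hW hD]

omit [Fintype V] in
/-- **(L_A) is `g⁻ ≥ x*`** when `P(PD, b ∉ C₁) > 0`, `W > 0` (FALSE in general: NEG-31). -/
theorem LA_iff_xstar_le_gMinus (p : E → R) (ends : E → Sym2 V) (o a₁ a₂ a₃ b : V)
    (hN : Nh p ends a₁ a₂ a₃ b ≠ 0) (hr : rb p ends a₁ a₂ a₃ b ≠ 0)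
    (hW : 0 < massM2 p ends a₁ a₂ a₃ b + deltaT p ends a₁ a₂ a₃ b)
    (hD : 0 < prob p (PDEvent ends a₁ a₂ a₃ ∩ (connEvent ends a₁ b)ᶜ)) :
    LA p ends o a₁ a₂ a₃ b ↔ xstar p ends o a₁ a₂ a₃ b ≤ gMinus p ends o a₁ a₂ a₃ b := by
  rw [xstar_eq_div p ends o a₁ a₂ a₃ b hN hr hW.ne', ← Tlh_sub_deltaL_eq]
  unfold gMinus LA
  rw [div_le_div_iff₀ hW hD]

omit [Fintype V] [DecidableEq V] [LinearOrder R] [IsStrictOrderedRing R] in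
/-- `g_l` is the convex combination `(D⁻ g⁻ + D⁺ g⁺) / (D⁻ + D⁺)` of the two b-split shares
(`D⁻ = P(PD, b ∉ C₁)`, `D⁺ = P(PD, b ∈ C₁)`, both `≠ 0`). -/
theorem gl_eq_convex (p : E → R) (ends : E → Sym2 V) (o a₁ a₂ a₃ b : V)
    (hm : prob p (PDEvent ends a₁ a₂ a₃ ∩ (connEvent ends a₁ b)ᶜ) ≠ 0)
    (hp' : prob p (PDEvent ends a₁ a₂ a₃ ∩ connEvent ends a₁ b) ≠ 0) :
    gl p ends o a₁ a₂ a₃ =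
      (prob p (PDEvent ends a₁ a₂ a₃ ∩ (connEvent ends a₁ b)ᶜ) * gMinus p ends o a₁ a₂ a₃ b +
          prob p (PDEvent ends a₁ a₂ a₃ ∩ connEvent ends a₁ b) * gPlus p ends o a₁ a₂ a₃ b) /
        (prob p (PDEvent ends a₁ a₂ a₃ ∩ (connEvent ends a₁ b)ᶜ) +
          prob p (PDEvent ends a₁ a₂ a₃ ∩ connEvent ends a₁ b)) := by
  unfold gl gMinus gPlus
  rw [prob_PD_split_b p ends a₁ a₂ a₃ b, prob_PDo_split_b p ends o a₁ a₂ a₃ b]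
  rw [mul_div_cancel₀ _ hm, mul_div_cancel₀ _ hp', add_comm (prob p (PDEvent ends a₁ a₂ a₃ ∩
    connEvent ends a₁ b)) (prob p (PDEvent ends a₁ a₂ a₃ ∩ (connEvent ends a₁ b)ᶜ)),
    add_comm (prob p (PDEvent ends a₁ a₂ a₃ ∩ connEvent ends a₁ o ∩ connEvent ends a₁ b))]

end ThresholdIdentities

section Anatomy

variable {V : Type*} {E : Type*} [Fintype E] [DecidableEq E] [Fintype V] [DecidableEq V]
  {R : Type*} [Field R] [LinearOrder R] [IsStrictOrderedRing R]

omit [Fintype V] [LinearOrder R] [IsStrictOrderedRing R] in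
/-- Tower identity: `P(o ∈ C₁, R) = E[1_o(C₁); R]`. -/
lemma tower_O (p : E → R) (ends : E → Sym2 V) (o a₁ a₂ a₃ : V) :
    massO p ends o a₁ a₂ a₃ =
      expect p (fun ω => ind o (cluster ends ω a₁) * (avoidAll ends a₁ {a₂, a₃}).indicator 1 ω) :=
  tower_b p ends a₁ a₂ a₃ o

/-- **`s_H ≤ ε` in product form** (BHK 1.3, `1_o` increasing, `β` decreasing):
`A · P(R) ≤ P(o ∈ C₁, R) · N_h`. -/
theorem massA_mul_le (p : E → R) (hp : IsProbVec p) (ends : E → Sym2 V) (o a₁ a₂ a₃ b : V) :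
    massA p ends o a₁ a₂ a₃ b * prob p (avoidAll ends a₁ {a₂, a₃}) ≤
      massO p ends o a₁ a₂ a₃ * Nh p ends a₁ a₂ a₃ b := by
  have h := bhk_induced p hp ends a₁ (F₁ := (ind o : Set V → R))
    (F₂ := fun W => 1 - beta p ends a₂ b W) (ind_mono o)
    (fun W W' hW => sub_le_sub_left (beta_anti p hp ends a₂ b hW) 1) (ind_nonneg o)
    (fun W => sub_nonneg.2 (beta_le_one p hp ends a₂ b W))
    Finset.univ {a₂, a₃} {a₂, a₃} (Finset.subset_univ _) (Finset.subset_univ _)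
  simp only [REvent_univ, Finset.inter_self, Finset.union_self, expect_clusterObs_univ,
    Pi.mul_apply] at h
  have e1 : expect p (fun ω => (1 - beta p ends a₂ b (cluster ends ω a₁)) *
      (avoidAll ends a₁ {a₂, a₃}).indicator 1 ω) =
      prob p (avoidAll ends a₁ {a₂, a₃}) - expect p (fun ω => beta p ends a₂ b (cluster ends ω a₁) *
        (avoidAll ends a₁ {a₂, a₃}).indicator 1 ω) := by
    rw [prob_eq_expect_indicator, ← expect_sub]
    congr 1
    funext ω
    simp only [Pi.sub_apply]
    ring
  have e2 : expect p (fun ω => ind o (cluster ends ω a₁) *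
      (1 - beta p ends a₂ b (cluster ends ω a₁)) * (avoidAll ends a₁ {a₂, a₃}).indicator 1 ω) =
      expect p (fun ω => ind o (cluster ends ω a₁) * (avoidAll ends a₁ {a₂, a₃}).indicator 1 ω) -
      expect p (fun ω => ind o (cluster ends ω a₁) * beta p ends a₂ b (cluster ends ω a₁) *
        (avoidAll ends a₁ {a₂, a₃}).indicator 1 ω) := by
    rw [← expect_sub]
    congr 1
    funext ω
    simp only [Pi.sub_apply]
    ring
  rw [e1, e2] at h
  unfold massA massO Nh
  rw [tower_ob, tower_b, tower_N]
  nlinarith [h]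

/-- **`ε ≤ g_l` in product form** (BHK 1.1, `1_o` and `u` increasing):
`P(o ∈ C₁, R) · P(PD) ≤ P(PD, o ∈ C₁) · P(R)`. -/
theorem massO_mul_le (p : E → R) (hp : IsProbVec p) (ends : E → Sym2 V) (o a₁ a₂ a₃ : V) :
    massO p ends o a₁ a₂ a₃ * prob p (PDEvent ends a₁ a₂ a₃) ≤
      prob p (PDEvent ends a₁ a₂ a₃ ∩ connEvent ends a₁ o) * prob p (avoidAll ends a₁ {a₂, a₃}) := by
  have h := bhk_induced p hp ends a₁ (F₁ := (ind o : Set V → R)) (F₂ := u p ends a₂ a₃)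
    (ind_mono o) (u_mono p hp ends a₂ a₃) (ind_nonneg o) (u_nonneg p hp ends a₂ a₃)
    Finset.univ {a₂, a₃} {a₂, a₃} (Finset.subset_univ _) (Finset.subset_univ _)
  simp only [REvent_univ, Finset.inter_self, Finset.union_self, expect_clusterObs_univ,
    Pi.mul_apply] at h
  unfold massO
  rw [tower_b, tower_PD, tower_PDo]
  exact h

/-- **`s_H ≤ g_l`** when `P(R) > 0`, `N_h > 0`, `P(PD) > 0` (the two BHK steps). -/
theorem shareH_le_gl (p : E → R) (hp : IsProbVec p) (ends : E → Sym2 V) (o a₁ a₂ a₃ b : V)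
    (hR : 0 < prob p (avoidAll ends a₁ {a₂, a₃})) (hN : 0 < Nh p ends a₁ a₂ a₃ b)
    (hD : 0 < prob p (PDEvent ends a₁ a₂ a₃)) :
    shareH p ends o a₁ a₂ a₃ b ≤ gl p ends o a₁ a₂ a₃ := by
  unfold shareH gl
  rw [div_le_div_iff₀ hN hD]
  have h1 := massA_mul_le p hp ends o a₁ a₂ a₃ b
  have h2 := massO_mul_le p hp ends o a₁ a₂ a₃
  have hA0 : 0 ≤ massA p ends o a₁ a₂ a₃ b := prob_nonneg hp _
  have hO0 : 0 ≤ massO p ends o a₁ a₂ a₃ := prob_nonneg hp _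
  -- `A · P(R) · D ≤ O · N_h · D ≤ C · P(R) · N_h`, then cancel `P(R) > 0`
  have h3 : massA p ends o a₁ a₂ a₃ b * prob p (avoidAll ends a₁ {a₂, a₃}) *
      prob p (PDEvent ends a₁ a₂ a₃) ≤
      prob p (PDEvent ends a₁ a₂ a₃ ∩ connEvent ends a₁ o) * prob p (avoidAll ends a₁ {a₂, a₃}) *
        Nh p ends a₁ a₂ a₃ b := by
    calc massA p ends o a₁ a₂ a₃ b * prob p (avoidAll ends a₁ {a₂, a₃}) *
          prob p (PDEvent ends a₁ a₂ a₃)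
        ≤ massO p ends o a₁ a₂ a₃ * Nh p ends a₁ a₂ a₃ b * prob p (PDEvent ends a₁ a₂ a₃) :=
          mul_le_mul_of_nonneg_right h1 hD.le
      _ = massO p ends o a₁ a₂ a₃ * prob p (PDEvent ends a₁ a₂ a₃) * Nh p ends a₁ a₂ a₃ b := by
          ring
      _ ≤ prob p (PDEvent ends a₁ a₂ a₃ ∩ connEvent ends a₁ o) *
            prob p (avoidAll ends a₁ {a₂, a₃}) * Nh p ends a₁ a₂ a₃ b :=
          mul_le_mul_of_nonneg_right h2 hN.le
  have h4 : (massA p ends o a₁ a₂ a₃ b * prob p (PDEvent ends a₁ a₂ a₃)) *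
      prob p (avoidAll ends a₁ {a₂, a₃}) ≤
      (prob p (PDEvent ends a₁ a₂ a₃ ∩ connEvent ends a₁ o) * Nh p ends a₁ a₂ a₃ b) *
        prob p (avoidAll ends a₁ {a₂, a₃}) := by
    linarith [h3]
  exact le_of_mul_le_mul_right h4 hR

omit [Fintype V] in
/-- **The threshold form of (Yu1Δ)** (lead 22:19:50Z): with `W = N_h − r_b > 0`, `P(PD) > 0`,
`N_h, r_b > 0`: `Yu1Delta ↔ r_b (g_l − s_L3) ≤ N_h (g_l − s_H)`. -/
theorem Yu1Delta_iff_threshold (p : E → R) (ends : E → Sym2 V) (o a₁ a₂ a₃ b : V)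
    (hN : 0 < Nh p ends a₁ a₂ a₃ b) (hr : 0 < rb p ends a₁ a₂ a₃ b)
    (hW : 0 < massM2 p ends a₁ a₂ a₃ b + deltaT p ends a₁ a₂ a₃ b)
    (hD : 0 < prob p (PDEvent ends a₁ a₂ a₃)) :
    Yu1Delta p ends o a₁ a₂ a₃ b ↔
      rb p ends a₁ a₂ a₃ b * (gl p ends o a₁ a₂ a₃ - shareL3 p ends o a₁ a₂ a₃ b) ≤
        Nh p ends a₁ a₂ a₃ b * (gl p ends o a₁ a₂ a₃ - shareH p ends o a₁ a₂ a₃ b) := by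
  rw [Yu1Delta_iff_xstar_le_gl p ends o a₁ a₂ a₃ b hN.ne' hr.ne' hW hD]
  have hWe := W_eq_Nh_sub_rb p ends a₁ a₂ a₃ b
  unfold xstar shareH shareL3
  rw [hWe] at hW ⊢
  have key : rb p ends a₁ a₂ a₃ b * (gl p ends o a₁ a₂ a₃ - massA' p ends o a₁ a₂ a₃ b /
      rb p ends a₁ a₂ a₃ b) ≤ Nh p ends a₁ a₂ a₃ b * (gl p ends o a₁ a₂ a₃ -
        massA p ends o a₁ a₂ a₃ b / Nh p ends a₁ a₂ a₃ b) ↔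
      massA p ends o a₁ a₂ a₃ b - massA' p ends o a₁ a₂ a₃ b ≤
        (Nh p ends a₁ a₂ a₃ b - rb p ends a₁ a₂ a₃ b) * gl p ends o a₁ a₂ a₃ := by
    rw [mul_sub, mul_sub, mul_div_cancel₀ _ hr.ne', mul_div_cancel₀ _ hN.ne']
    constructor
    · intro h
      linarith
    · intro h
      linarith
  rw [key]
  have e : massA p ends o a₁ a₂ a₃ b / Nh p ends a₁ a₂ a₃ b +
      rb p ends a₁ a₂ a₃ b / (Nh p ends a₁ a₂ a₃ b - rb p ends a₁ a₂ a₃ b) *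
        (massA p ends o a₁ a₂ a₃ b / Nh p ends a₁ a₂ a₃ b -
          massA' p ends o a₁ a₂ a₃ b / rb p ends a₁ a₂ a₃ b) =
      (massA p ends o a₁ a₂ a₃ b - massA' p ends o a₁ a₂ a₃ b) /
        (Nh p ends a₁ a₂ a₃ b - rb p ends a₁ a₂ a₃ b) := by
    field_simp
    ring
  rw [e, div_le_iff₀ hW, mul_comm]

end Anatomy

end Threshold

end Summit.Ventures.PercRepro2
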